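import Mathlib
import HarnessLib
import Literature.Combinatorics.Additive.RestrictedSumsetSubmultiplicativity

/-!
# Restricted submultiplicativity for several summands: the Balister–Bollobás inequality
# `|A + C|ʰ ≤ |C|^{h−1} ∏ᵢ |A + Bᵢ|` (C ⊆ B₁ + ⋯ + B_h), and Ruzsa's Plünnecke inequality for
# different summands

Topic `Literature/Combinatorics/Additive`.  Cell `mm-stpp` (D-0046), seat `mm-stpp-lit` (gen 11);
sequel of `RestrictedSumsetSubmultiplicativity.lean` (Gyarmati–Matolcsi–Ruzsa 2010 Thm 1.4, the
case `h = 2`, with GMR §4 for two summands), whose Plünnecke-with-a-subset lemma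
`exists_subset_card_add_nsmul_le` is reused here.

**Theorem (Balister–Bollobás 2012, Thm 9; Murphy–Palsson–Petridis 2015, Thm 4).**  "If
`A, B₁, …, B_k` are finite sets [of integers (BB); in a commutative group (MPP)] and
`C ⊆ B₁ + ⋯ + B_k`, then `|A + C|ᵏ ≤ |C|^{k−1} ∏ᵢ |A + Bᵢ|`" —
`card_add_pow_le_card_pow_mul_prod_card_add` (any additive commutative group, every `k = h ≥ 0`;
`h = 2` is GMR 2010 Thm 1.4; ratio form `card_add_pow_le_of_doubling`:
`|A + C| ≤ (α₁⋯α_h)^{1/h} m |C|^{1−1/h}`); with `C = Σ Bᵢ` and Ruzsa's inequality it gives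
[MPP15, Thm 1] `|A + B₁ + ⋯ + B_h| ≤ α₁⋯α_h m^{2−1/h}` — `card_add_sum_pow_mul_card_pow_le`
(appended 2026-08-27, same seat).

**Theorem (Ruzsa 1989; GMR 2010 Thm 4.2; MPP 2015 Thm 5).**  "`|A| = m`, `|A + Bᵢ| ≤ αᵢ m` ⇒
`|B₁ + ⋯ + B_h| ≤ α₁⋯α_h m`" — `card_sum_mul_card_pow_le_prod_card_add` (the `X`-free form with
the printed constant `1`); and the subset form "there is `∅ ≠ X ⊆ A` with
`|X + B₁ + ⋯ + B_h| ≤ α₁⋯α_h |X|`" in the WEAK FORM with a factor `hʰ` —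
`exists_subset_card_add_sum_le` (the printed constant `1` for the subset form needs Plünnecke's
commutative-graph inequality and the hypercube-product trick of [MPP15, §5]; absent here, and not
needed below).

PROOF ROUTE (a DEVIATION from the printed proofs of the Balister–Bollobás inequality, forced —
see the next paragraph): Gyarmati–Matolcsi–Ruzsa 2010 §4 (held `paper:arxiv-0707.2707` p0007) run
for `h` summands — weak Thm 4.2 by Plünnecke–Petridis in `G × ℤʰ` on `⋃ᵢ Bᵢ × Tᵢ`,
`Tᵢ = {n·eᵢ : n < Nᵢ}`, `Nᵢ = ∏_{j≠i} |A + Bⱼ|` (Ruzsa's product-set equalisation, as in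
[MPP15, §3 and proof of Thm 15]); Thm 4.3 by the printed induction
(`exists_large_subset_card_add_sum_le`); a discrete telescoping in place of Thm 4.4
(`…le'`, `Σ_{j<k} (m−j)^{−h} ≤ (m−k)^{1−h}` up to a constant); the printed case analysis of the
proof of GMR Thm 1.4 with the integer cut `m − |X| = ⌈(s′/|C|)^{1/h}⌉`, giving
`|A + C| ≤ 3 (s′|C|^{h−1})^{1/h}`, `s′ = hʰ ∏|A + Bᵢ|` (`RestrictedSubmultSeveral.card_add_pow_le_const`,
constant `(3h)ʰ`); and the printed direct-power step of GMR ("`A′ = Aᵏ, Bᵢ′ = Bᵢᵏ, S′ = Sᵏ` …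
`k → ∞`") via `Fintype.piFinset` over `Fin n → G`, which removes every constant.  The `X`-free
Ruzsa inequality is obtained the same way from the weak subset form.

WHY NOT THE PRINTED PROOFS.  Balister–Bollobás (held `paper:arxiv-0711.1151`, §5, proof of Thm 9)
take `S′ = φ_{[n]}(C + A)`, the set of lexicographically least representations in
`B₁ × ⋯ × B_k × A` of the elements of `C + A`, and assert `|S′_{[k]}| ≤ |C|` before applying the
uniform-cover inequality; Madiman–Marcus–Tetali (held `paper:arxiv-0901.0055`, Thm 5 / Cor 4)
assert correspondingly `f_{[k]}(f_{[k+1]}^{−1}(A + D)) = D`.  Both assertions hold for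
`C = B₁ + ⋯ + B_k` (GMR's projection lemma) but FAIL for general `C ⊊ B₁ + ⋯ + B_k`: with
`B₁ = {0,1,2}`, `B₂ = {0}`, `A = {0,1}`, `C = {1}` one has `C + A = {1,2}`, and the lexicographically
least representations are `(0,0,1), (1,0,1)` (coordinate `A` last) resp. `(0; 1,0), (0; 2,0)`
(coordinate `A` first), whose `[k]`-projections have 2 > 1 = |C| elements, their sums `{0,1}` resp.
`{1,2}` not lying in `C` (seat check `calc/bb_step_check.py`); the inequality itself holds there
(`4 ≤ 8`).  Nor can the argument be repaired by another choice of orders or representatives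
(BB: "there are many other orders we could choose"): for `B₁ = {3,4,5,7}`, `B₂ = {2,6}`,
`A = {0,2,3,7}`, `C = {5,10}` (where `49 ≤ 154` holds) none of the 128 representative systems of
`C + A` in `B₁ × B₂ × A` has `|S′_{[2]}| ≤ |C|` together with injective sum maps on the two
pair-projections, which is what the uniform-cover step consumes (exhaustive seat check
`calc/bb_repsystem_verify.py`).  So the printed projection proofs establish the theorem only for
`C = B₁ + ⋯ + B_k` (the case [MPP15] use); the general case is proved here by the Plünnecke route,
for every `h`.
NOT FORMALIZED / OPEN AS FAR AS THIS FILE KNOWS: the leave-one-out family of [MMT12, Cor 4]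
(`|A + D|ᵏ ≤ |D| ∏ᵢ |A + Σ_{j≠i} Bⱼ|`, i.e. GMR 2010 Problem 1.5, printed OPEN in GMR 2010 and
claimed in [MMT12] by the same gapped argument — no counterexample found in a random search,
`k = 3`; not a Literature item); Ruzsa's subset form with constant `1`
(`-- TODO(general form)`); [MPP15]'s main Theorem 3 (the sharp `m^{2−1/h}` bound).
Census-silent for the cell `mm-stpp`.
-- TODO(general form): Ruzsa's subset form with constant 1 and MPP15 Cor 18 (component removed).

## References
* P. Balister, B. Bollobás, *Projections, entropy and sumsets*, Combinatorica 32 (2012) 125–141,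
  §5 Thm 9 (and Thm 8) — held `paper:arxiv-0711.1151`, chunks p0008–p0010 read 2026-08-27
  [cite: BalisterBollobas2012, Thm 9].
* B. Murphy, E. A. Palsson, G. Petridis, *The cardinality of sumsets: different summands*, Acta
  Arith. 167 (2015) 375–395, Thms 4–5, §3 (product-set equalisation), §5 (hypercube graphs) —
  held `paper:arxiv-1309.2191`, read in full 2026-08-27 [cite: MurphyPalssonPetridis2015, Thm 4;
  Thm 5].
* M. Madiman, A. W. Marcus, P. Tetali, *Entropy and set cardinality inequalities for
  partition-determined functions*, Random Struct. Alg. 40 (2012) 399–424, Thm 5 / Cor 4 — held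
  `paper:arxiv-0901.0055`, chunks p0008–p0010 read 2026-08-27 [cite: MadimanMarcusTetali2011,
  Cor 4 (singleton family)].
* K. Gyarmati, M. Matolcsi, I. Z. Ruzsa, Combinatorica 30 (2010) 163–174, §4 and Problem 1.5 —
  held `paper:arxiv-0707.2707` [cite: GyarmatiMatolcsiRuzsa2010, §4 Thms 4.2–4.4].
* I. Z. Ruzsa, *An application of graph theory to additive number theory*, Scientia Ser. A 3
  (1989) 97–109 (not held; cited from GMR/MPP).
-/

namespace Literature.Combinatorics.Additive

open Finset
open scoped Pointwise

variable {G : Type*} [AddCommGroup G] [DecidableEq G]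

namespace RestrictedSubmultSeveral

/-- [folklore] A subset of `A ×ˢ {c}` is the product of its first projection with `{c}`. -/
private theorem eq_image_fst_product_of_subset {α β : Type*} [DecidableEq α] [DecidableEq β]
    {s : Finset (α × β)} {A : Finset α} {c : β} (h : s ⊆ A ×ˢ {c}) :
    s = s.image Prod.fst ×ˢ {c} := by
  ext ⟨x, y⟩
  constructor
  · intro hp
    have hy : y = c := by
      have := h hp
      rw [mem_product, mem_singleton] at this
      exact this.2
    subst hy
    exact mem_product.2 ⟨mem_image.2 ⟨(x, y), hp, rfl⟩, mem_singleton_self _⟩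
  · intro hp
    rw [mem_product, mem_singleton, mem_image] at hp
    obtain ⟨⟨⟨x', y'⟩, hq, hx⟩, hy⟩ := hp
    have hy' : y' = c := by
      have := h hq
      rw [mem_product, mem_singleton] at this
      exact this.2
    simp only at hx
    subst hx; subst hy; subst hy'
    exact hq

/-- [folklore] A sum with an empty summand is empty. -/
private theorem sum_eq_empty_of_eq_empty {ι : Type*} (s : Finset ι) (S : ι → Finset G) {i : ι}
    (hi : i ∈ s) (h : S i = ∅) : ∑ j ∈ s, S j = ∅ := by
  classical
  rw [← Finset.add_sum_erase s S hi, h, empty_add]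

/-- [folklore] `∑ᵢ Sᵢ ⊆ |s| • T` when every `Sᵢ ⊆ T`. -/
private theorem sum_subset_nsmul {ι : Type*} (s : Finset ι) (S : ι → Finset G) (T : Finset G)
    (h : ∀ i ∈ s, S i ⊆ T) : ∑ i ∈ s, S i ⊆ #s • T := by
  classical
  induction s using Finset.induction_on with
  | empty => simp
  | insert a s ha ih =>
    rw [sum_insert ha, card_insert_of_notMem ha, succ_nsmul']
    exact add_subset_add (h a (mem_insert_self a s))
      (ih fun i hi => h i (mem_insert_of_mem hi))

/-- [folklore] Sums of product sets are product sets of sums. -/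
private theorem sum_product_eq {ι α β : Type*} [AddCommMonoid α] [AddCommMonoid β]
    [DecidableEq α] [DecidableEq β] (s : Finset ι) (S : ι → Finset α) (U : ι → Finset β) :
    ∑ i ∈ s, (S i ×ˢ U i) = (∑ i ∈ s, S i) ×ˢ (∑ i ∈ s, U i) := by
  classical
  induction s using Finset.induction_on with
  | empty =>
    simp only [sum_empty]
    rw [← singleton_zero, ← singleton_zero, ← singleton_zero, singleton_product_singleton]
    rfl
  | insert a s ha ih =>
    rw [sum_insert ha, sum_insert ha, sum_insert ha, ih, product_add_product_comm]

/-- [folklore] `∑ᵢ g i ∈ ∑ᵢ S i` when each `g i ∈ S i`. -/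
private theorem sum_mem_sum' {ι α : Type*} [AddCommMonoid α] [DecidableEq α] (s : Finset ι)
    (S : ι → Finset α) (g : ι → α) (h : ∀ i ∈ s, g i ∈ S i) : ∑ i ∈ s, g i ∈ ∑ i ∈ s, S i := by
  classical
  induction s using Finset.induction_on with
  | empty => simp
  | insert a s ha ih =>
    rw [sum_insert ha, sum_insert ha]
    exact add_mem_add (h a (mem_insert_self a s)) (ih fun i hi => h i (mem_insert_of_mem hi))

/-- [folklore] `s + ⋃ᵢ f i ⊆ ⋃ᵢ (s + f i)`. -/
private theorem add_biUnion_subset {ι α : Type*} [DecidableEq α] [Add α] [DecidableEq ι]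
    (s : Finset α) (t : Finset ι) (f : ι → Finset α) :
    s + t.biUnion f ⊆ t.biUnion fun i => s + f i := by
  intro x hx
  rw [mem_add] at hx
  obtain ⟨a, ha, b, hb, rfl⟩ := hx
  rw [mem_biUnion] at hb
  obtain ⟨i, hi, hb⟩ := hb
  exact mem_biUnion.2 ⟨i, hi, add_mem_add ha hb⟩

end RestrictedSubmultSeveral

open RestrictedSubmultSeveral

/-- **Ruzsa's Plünnecke inequality for different summands — WEAK FORM (factor `hʰ`).**
Printed (GMR 2010 Thm 4.2 = Ruzsa 1989; Murphy–Palsson–Petridis 2015 Thm 5): "`|A| = m`,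
`|A + Bᵢ| ≤ αᵢ m` (`1 ≤ i ≤ h`) ⇒ there is `∅ ≠ X ⊆ A` with `|X + B₁ + ⋯ + B_h| ≤ α₁⋯α_h |X|`."
Proved here with an extra factor `hʰ` (multiplied out:
`|X + Σᵢ Bᵢ|·mʰ ≤ hʰ · ∏ᵢ|A + Bᵢ| · |X|`): Plünnecke–Petridis in `G × ℤʰ` applied to
`⋃ᵢ Bᵢ × Tᵢ` with `Tᵢ = {n eᵢ : n < Nᵢ}`, `Nᵢ = ∏_{j ≠ i} |A + Bⱼ|` (Ruzsa's product-set
equalisation of the ratios; the printed constant `1` needs Plünnecke's commutative-graph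
inequality and the hypercube-product trick of [MPP15, §5], not available here).
[cite: GyarmatiMatolcsiRuzsa2010, Thm 4.2 (weak form, constant hʰ instead of 1)] -/
theorem exists_subset_card_add_sum_le {h : ℕ} (B : Fin h → Finset G) (A : Finset G)
    (hA : A.Nonempty) :
    ∃ X ⊆ A, X.Nonempty ∧
      #(X + ∑ i, B i) * #A ^ h ≤ h ^ h * (∏ i, #(A + B i)) * #X := by
  classical
  -- trivial when some `B i` is empty
  by_cases hB : ∃ i, B i = ∅
  · obtain ⟨i, hi⟩ := hB
    refine ⟨A, subset_rfl, hA, ?_⟩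
    rw [sum_eq_empty_of_eq_empty univ B (mem_univ i) hi, add_empty, card_empty, zero_mul]
    exact Nat.zero_le _
  push Not at hB
  have hBne : ∀ i, (B i).Nonempty := hB
  -- the data
  set P : ℕ := ∏ i, #(A + B i) with hP
  have hPpos : 0 < P := by
    rw [hP]; exact prod_pos fun i _ => (hA.add (hBne i)).card_pos
  let N : Fin h → ℕ := fun i => ∏ j ∈ univ.erase i, #(A + B j)
  have hN : ∀ i, N i * #(A + B i) = P := fun i =>
    prod_erase_mul univ (fun j => #(A + B j)) (mem_univ i)
  let V := Fin h → ℤ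
  let T : Fin h → Finset V := fun i => (range (N i)).image fun n : ℕ => (Pi.single i (n : ℤ) : V)
  have hT : ∀ i, #(T i) = N i := by
    intro i
    rw [card_image_of_injective _ ?_, card_range]
    intro a b hab
    have := congrArg (fun f : V => f i) hab
    simpa using this
  let A' : Finset (G × V) := A ×ˢ {0}
  let B' : Fin h → Finset (G × V) := fun i => B i ×ˢ T i
  let Bu : Finset (G × V) := univ.biUnion B'
  have hA'card : #A' = #A := by simp [A']
  have hA'ne : A'.Nonempty := by rw [← card_pos, hA'card]; exact hA.card_pos
  -- `|A' + B'ᵢ| = P` for every `i`, hence `|A' + Bu| ≤ h P`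
  have hAB : ∀ i, #(A' + B' i) = P := by
    intro i
    have : A' + B' i = (A + B i) ×ˢ ({0} + T i) := by
      simp only [A', B', product_add_product_comm]
    rw [this, card_product, singleton_zero, zero_add, hT, mul_comm, hN]
  have hQ : #(A' + Bu) ≤ h * P := by
    calc #(A' + Bu) ≤ #(univ.biUnion fun i => A' + B' i) :=
          card_le_card (add_biUnion_subset A' univ B')
      _ ≤ ∑ i, #(A' + B' i) := card_biUnion_le
      _ = ∑ _i : Fin h, P := by simp_rw [hAB]
      _ = h * P := by simp
  -- Plünnecke with a subset (h-fold, same summand `Bu`)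
  obtain ⟨X', hX'A, hX'ne, hpl⟩ := exists_subset_card_add_nsmul_le A' Bu hA'ne h
  -- pull back
  set X := X'.image Prod.fst with hXdef
  have hX'eq : X' = X ×ˢ ({0} : Finset V) := by
    have := eq_image_fst_product_of_subset hX'A
    rw [this]
  have hXA : X ⊆ A := by
    intro x hx
    rw [hXdef, mem_image] at hx
    obtain ⟨p, hp, rfl⟩ := hx
    exact (mem_product.1 (hX'A hp)).1
  have hXcard : #X' = #X := by rw [hX'eq, card_product, card_singleton, mul_one]
  have hXne : X.Nonempty := by rw [← card_pos, ← hXcard]; exact hX'ne.card_pos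
  -- the box over `X + Σ B`
  have hbox : X' + ∑ i, B' i = (X + ∑ i, B i) ×ˢ ({0} + ∑ i, T i) := by
    rw [hX'eq, show (∑ i, B' i) = (∑ i, B i) ×ˢ (∑ i, T i) from sum_product_eq univ B T,
      product_add_product_comm]
  -- `∏ Nᵢ ≤ |Σ Tᵢ|` : the box of exponent vectors sits inside `Σ Tᵢ`
  have hTsum : ∏ i, N i ≤ #(∑ i, T i) := by
    let e : (Fin h → ℕ) → V := fun v i => (v i : ℤ)
    have he : Function.Injective e := by
      intro v w hvw; funext i
      have := congrArg (fun f : V => f i) hvw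
      simpa [e] using this
    have hsub : (Fintype.piFinset fun i => range (N i)).image e ⊆ ∑ i, T i := by
      intro x hx
      rw [mem_image] at hx
      obtain ⟨v, hv, rfl⟩ := hx
      rw [Fintype.mem_piFinset] at hv
      have : e v = ∑ i, (Pi.single i (v i : ℤ) : V) := by
        rw [Finset.univ_sum_single]
      rw [this]
      exact sum_mem_sum' univ T _ fun i _ => mem_image.2 ⟨v i, hv i, rfl⟩
    calc ∏ i, N i = #(Fintype.piFinset fun i => range (N i)) := by
          rw [Fintype.card_piFinset]; simp
      _ = #((Fintype.piFinset fun i => range (N i)).image e) := (card_image_of_injective _ he).symm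
      _ ≤ #(∑ i, T i) := card_le_card hsub
  -- `Σ B'ᵢ ⊆ h • Bu`
  have hsub : X' + ∑ i, B' i ⊆ X' + h • Bu := by
    refine add_subset_add_left ?_
    have := sum_subset_nsmul univ B' Bu fun i _ => subset_biUnion_of_mem B' (mem_univ i)
    simpa using this
  -- counting
  have h1 : #(X + ∑ i, B i) * ∏ i, N i ≤ #(X' + h • Bu) := by
    calc #(X + ∑ i, B i) * ∏ i, N i ≤ #(X + ∑ i, B i) * #(∑ i, T i) :=
          Nat.mul_le_mul_left _ hTsum
      _ = #(X' + ∑ i, B' i) := by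
          rw [hbox, card_product, singleton_zero, zero_add]
      _ ≤ #(X' + h • Bu) := card_le_card hsub
  have h2 : #(X + ∑ i, B i) * (∏ i, N i) * #A ^ h ≤ (h * P) ^ h * #X := by
    calc #(X + ∑ i, B i) * (∏ i, N i) * #A ^ h ≤ #(X' + h • Bu) * #A' ^ h := by
          rw [hA'card]; exact Nat.mul_le_mul_right _ h1
      _ ≤ #(A' + Bu) ^ h * #X' := hpl
      _ ≤ (h * P) ^ h * #X' := Nat.mul_le_mul_right _ (Nat.pow_le_pow_left hQ h)
      _ = (h * P) ^ h * #X := by rw [hXcard]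
  have hNP : (∏ i, N i) * P = P ^ h := by
    calc (∏ i, N i) * P = (∏ i, N i) * ∏ i, #(A + B i) := by rw [hP]
      _ = ∏ i, (N i * #(A + B i)) := (prod_mul_distrib).symm
      _ = ∏ _i : Fin h, P := by simp_rw [hN]
      _ = P ^ h := by simp
  refine ⟨X, hXA, hXne, ?_⟩
  have hPh : 0 < P ^ h := pow_pos hPpos h
  have h3 : #(X + ∑ i, B i) * #A ^ h * P ^ h ≤ h ^ h * P * #X * P ^ h := by
    calc #(X + ∑ i, B i) * #A ^ h * P ^ h
        = #(X + ∑ i, B i) * (∏ i, N i) * #A ^ h * P := by rw [← hNP]; ring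
      _ ≤ (h * P) ^ h * #X * P := Nat.mul_le_mul_right _ h2
      _ = h ^ h * P * #X * P ^ h := by rw [mul_pow]; ring
  exact Nat.le_of_mul_le_mul_right h3 hPh

/-- **GMR 2010, Theorem 4.3 (h summands)** with the constant of the weak Theorem 4.2 (the printed
`s = ∏|A + Bᵢ|` replaced by `s' = hʰ s`): for `1 ≤ k ≤ m = |A|` some `X ⊆ A`, `|X| ≥ k`, has
`|X + Σ Bᵢ| ≤ Σ_{j<k} s'/(m−j)ʰ + (|X| − k)·s'/(m−k+1)ʰ`.  Proof as printed (induction on `k`,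
Theorem 4.2 applied to `A ∖ X`). [cite: GyarmatiMatolcsiRuzsa2010, Thm 4.3 (with s replaced by hʰ·s)] -/
theorem exists_large_subset_card_add_sum_le {h : ℕ} (B : Fin h → Finset G) (A : Finset G)
    {k : ℕ} (hk : 1 ≤ k) (hkm : k ≤ #A) :
    ∃ X ⊆ A, k ≤ #X ∧
      (#(X + ∑ i, B i) : ℝ) ≤
        (∑ j ∈ range k, ((h : ℝ) ^ h * ∏ i, (#(A + B i) : ℝ)) / ((#A : ℝ) - j) ^ h) +
          ((#X : ℝ) - k) * (((h : ℝ) ^ h * ∏ i, (#(A + B i) : ℝ)) / ((#A : ℝ) - k + 1) ^ h) := by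
  classical
  -- abbreviate `s' = hʰ ∏|A + Bᵢ|` and `m = |A|` (generalised, to keep the terms small)
  have hs'0 : (0 : ℝ) ≤ (h : ℝ) ^ h * ∏ i, (#(A + B i) : ℝ) := by positivity
  have key : ∀ s' : ℝ, ((h : ℝ) ^ h * ∏ i, (#(A + B i) : ℝ)) = s' → ∀ m : ℕ, #A = m →
      ∃ X ⊆ A, k ≤ #X ∧ (#(X + ∑ i, B i) : ℝ) ≤
        (∑ j ∈ range k, s' / ((m : ℝ) - j) ^ h) + ((#X : ℝ) - k) * (s' / ((m : ℝ) - k + 1) ^ h) := by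
    intro s' hs' m hm
    rw [hs'] at hs'0
    rw [hm] at hkm
    induction k, hk using Nat.le_induction with
    | base =>
      have hA : A.Nonempty := by rw [← card_pos]; omega
      obtain ⟨X, hXA, hXne, hX⟩ := exists_subset_card_add_sum_le B A hA
      refine ⟨X, hXA, Nat.succ_le_of_lt hXne.card_pos, ?_⟩
      have hm0 : (0 : ℝ) < m := by rw [← hm]; exact_mod_cast hA.card_pos
      have hX' : (#(X + ∑ i, B i) : ℝ) * (m : ℝ) ^ h ≤ s' * #X := by
        have h0 : ((#(X + ∑ i, B i) * #A ^ h : ℕ) : ℝ) ≤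
            ((h ^ h * (∏ i, #(A + B i)) * #X : ℕ) : ℝ) := by exact_mod_cast hX
        push_cast at h0
        rw [← hs', ← hm]; nlinarith [h0]
      have : (#(X + ∑ i, B i) : ℝ) ≤ s' * #X / (m : ℝ) ^ h := by
        rw [le_div_iff₀ (by positivity)]; exact hX'
      rw [range_one, sum_singleton, Nat.cast_zero, sub_zero, Nat.cast_one]
      calc (#(X + ∑ i, B i) : ℝ) ≤ s' * #X / (m : ℝ) ^ h := this
        _ = s' / (m : ℝ) ^ h + ((#X : ℝ) - 1) * (s' / ((m : ℝ) - 1 + 1) ^ h) := by ring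
    | succ k hk ih =>
      have hkm' : k ≤ m := by omega
      obtain ⟨X, hXA, hXk, hXb⟩ := ih hkm'
      have hmk : (1 : ℝ) ≤ (m : ℝ) - k := by
        have : (k : ℝ) + 1 ≤ m := by exact_mod_cast hkm
        linarith
      by_cases hbig : k + 1 ≤ #X
      · refine ⟨X, hXA, hbig, ?_⟩
        rw [sum_range_succ]
        have hxk : (1 : ℝ) ≤ (#X : ℝ) - k := by
          have : ((k + 1 : ℕ) : ℝ) ≤ #X := by exact_mod_cast hbig
          push_cast at this; linarith
        have hden : s' / ((m : ℝ) - k + 1) ^ h ≤ s' / ((m : ℝ) - k) ^ h := by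
          apply div_le_div_of_nonneg_left hs'0 (pow_pos (by linarith) h)
          exact pow_le_pow_left₀ (by linarith) (by linarith) h
        push_cast
        calc (#(X + ∑ i, B i) : ℝ)
            ≤ (∑ j ∈ range k, s' / ((m : ℝ) - j) ^ h) +
                ((#X : ℝ) - k) * (s' / ((m : ℝ) - k + 1) ^ h) := hXb
          _ ≤ (∑ j ∈ range k, s' / ((m : ℝ) - j) ^ h) +
                ((#X : ℝ) - k) * (s' / ((m : ℝ) - k) ^ h) := by gcongr
          _ = (∑ j ∈ range k, s' / ((m : ℝ) - j) ^ h) + s' / ((m : ℝ) - k) ^ h +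
                ((#X : ℝ) - (k + 1)) * (s' / ((m : ℝ) - (k + 1) + 1) ^ h) := by ring
      · have hXeq : #X = k := by omega
        have hAX : (A \ X).Nonempty := by
          rw [← card_pos, card_sdiff_of_subset hXA, hm]; omega
        obtain ⟨Y, hYA, hYne, hY⟩ := exists_subset_card_add_sum_le B (A \ X) hAX
        have hcardAX : #(A \ X) = m - k := by rw [card_sdiff_of_subset hXA, hm, hXeq]
        have hdisj : Disjoint X Y := disjoint_of_subset_right hYA disjoint_sdiff
        refine ⟨X ∪ Y, union_subset hXA (hYA.trans sdiff_subset), ?_, ?_⟩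
        · rw [card_union_of_disjoint hdisj, hXeq]
          have := hYne.card_pos; omega
        have hY' : (#(Y + ∑ i, B i) : ℝ) * ((m : ℝ) - k) ^ h ≤ s' * #Y := by
          have hmono : h ^ h * (∏ i, #(A \ X + B i)) * #Y ≤ h ^ h * (∏ i, #(A + B i)) * #Y := by
            apply Nat.mul_le_mul_right
            apply Nat.mul_le_mul_left
            exact prod_le_prod' fun i _ => card_le_card (add_subset_add_right sdiff_subset)
          have h1 : ((#(Y + ∑ i, B i) * #(A \ X) ^ h : ℕ) : ℝ) ≤
              ((h ^ h * (∏ i, #(A + B i)) * #Y : ℕ) : ℝ) := by exact_mod_cast hY.trans hmono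
          push_cast at h1
          have h3 : ((#(A \ X) : ℕ) : ℝ) = (m : ℝ) - k := by
            rw [hcardAX, Nat.cast_sub hkm']
          rw [← h3, ← hs']; exact h1
        have hYb : (#(Y + ∑ i, B i) : ℝ) ≤ s' * #Y / ((m : ℝ) - k) ^ h := by
          rw [le_div_iff₀ (by positivity)]; exact hY'
        have hunion : (#((X ∪ Y) + ∑ i, B i) : ℝ) ≤ #(X + ∑ i, B i) + #(Y + ∑ i, B i) := by
          rw [union_add]; exact_mod_cast card_union_le _ _
        rw [sum_range_succ, card_union_of_disjoint hdisj, hXeq]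
        push_cast
        have hXb' : (#(X + ∑ i, B i) : ℝ) ≤ ∑ j ∈ range k, s' / ((m : ℝ) - j) ^ h := by
          have := hXb; rwa [hXeq, sub_self, zero_mul, add_zero] at this
        calc (#((X ∪ Y) + ∑ i, B i) : ℝ) ≤ #(X + ∑ i, B i) + #(Y + ∑ i, B i) := hunion
          _ ≤ (∑ j ∈ range k, s' / ((m : ℝ) - j) ^ h) + s' * #Y / ((m : ℝ) - k) ^ h :=
              add_le_add hXb' hYb
          _ = (∑ j ∈ range k, s' / ((m : ℝ) - j) ^ h) + s' / ((m : ℝ) - k) ^ h +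
                ((k : ℝ) + #Y - (k + 1)) * (s' / ((m : ℝ) - (k + 1) + 1) ^ h) := by ring

  exact key _ rfl _ rfl
namespace RestrictedSubmultSeveral

/-- [folklore] `Σ_{j<k} 1/(m−j)² ≤ 1/(m−k)` for `k + 1 ≤ m` (telescoping). -/
private theorem sum_inv_sq_le {m k : ℕ} (hkm : k + 1 ≤ m) :
    ∑ j ∈ range k, 1 / ((m : ℝ) - j) ^ 2 ≤ 1 / ((m : ℝ) - k) := by
  have hmk : (1 : ℝ) ≤ (m : ℝ) - k := by
    have : (k : ℝ) + 1 ≤ m := by exact_mod_cast hkm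
    linarith
  have hterm : ∀ j ∈ range k, 1 / ((m : ℝ) - j) ^ 2 ≤
      (1 / ((m : ℝ) - (j + 1 : ℕ)) - 1 / ((m : ℝ) - j)) := by
    intro j hj
    rw [mem_range] at hj
    have hj' : (j : ℝ) + 1 ≤ k := by exact_mod_cast hj
    push_cast
    have hp1 : (0 : ℝ) < (m : ℝ) - (j + 1) := by linarith
    have hp2 : (0 : ℝ) < (m : ℝ) - j := by linarith
    rw [div_sub_div _ _ hp1.ne' hp2.ne', div_le_div_iff₀ (pow_pos hp2 2) (mul_pos hp1 hp2)]
    nlinarith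
  calc ∑ j ∈ range k, 1 / ((m : ℝ) - j) ^ 2
      ≤ ∑ j ∈ range k, (1 / ((m : ℝ) - (j + 1 : ℕ)) - 1 / ((m : ℝ) - j)) := sum_le_sum hterm
    _ = 1 / ((m : ℝ) - k) - 1 / (m : ℝ) := by
        rw [Finset.sum_range_sub (fun j => 1 / ((m : ℝ) - (j : ℕ)))]; simp
    _ ≤ 1 / ((m : ℝ) - k) := by
        have : (0 : ℝ) ≤ 1 / (m : ℝ) := by positivity
        linarith

end RestrictedSubmultSeveral

/-- Telescoped form of Theorem 4.3 (h ≥ 2 summands, weak constant), the discrete stand-in for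
GMR's Theorem 4.4: for `1 ≤ k ≤ m − 1` some `X ⊆ A`, `|X| ≥ k`, has
`|X + Σ Bᵢ| ≤ s'/(m − k)^{h−1} + (|X| − k)·s'/(m − k)ʰ`, `s' = hʰ ∏|A + Bᵢ|`
(from `Σ_{j<k} 1/(m−j)ʰ ≤ (m−k)^{2−h} Σ_{j<k} 1/(m−j)² ≤ 1/(m−k)^{h−1}`).
[cite: GyarmatiMatolcsiRuzsa2010, Thm 4.4 (discrete form)] -/
theorem exists_large_subset_card_add_sum_le' {h : ℕ} (hh : 2 ≤ h) (B : Fin h → Finset G)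
    (A : Finset G) {k : ℕ} (hk : 1 ≤ k) (hkm : k + 1 ≤ #A) :
    ∃ X ⊆ A, k ≤ #X ∧
      (#(X + ∑ i, B i) : ℝ) ≤
        ((h : ℝ) ^ h * ∏ i, (#(A + B i) : ℝ)) / ((#A : ℝ) - k) ^ (h - 1) +
          ((#X : ℝ) - k) * (((h : ℝ) ^ h * ∏ i, (#(A + B i) : ℝ)) / ((#A : ℝ) - k) ^ h) := by
  obtain ⟨X, hXA, hXk, hXb⟩ := exists_large_subset_card_add_sum_le B A hk (by omega)
  refine ⟨X, hXA, hXk, ?_⟩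
  generalize hs' : ((h : ℝ) ^ h * ∏ i, (#(A + B i) : ℝ)) = s' at hXb ⊢
  generalize hm : #A = m at hXb hkm ⊢
  have hs'0 : 0 ≤ s' := by rw [← hs']; positivity
  have hmk : (1 : ℝ) ≤ (m : ℝ) - k := by
    have : (k : ℝ) + 1 ≤ m := by exact_mod_cast hkm
    linarith
  have hxk : (0 : ℝ) ≤ (#X : ℝ) - k := by
    have : (k : ℝ) ≤ #X := by exact_mod_cast hXk
    linarith
  obtain ⟨h₂, rfl⟩ : ∃ h₂, h = h₂ + 2 := ⟨h - 2, by omega⟩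
  -- each term: `s'/(m-j)^(h₂+2) ≤ (s'/(m-k)^h₂) * (1/(m-j)^2)`
  have hterm : ∀ j ∈ range k, s' / ((m : ℝ) - j) ^ (h₂ + 2) ≤
      s' / ((m : ℝ) - k) ^ h₂ * (1 / ((m : ℝ) - j) ^ 2) := by
    intro j hj
    rw [mem_range] at hj
    have hj' : (j : ℝ) + 1 ≤ k := by exact_mod_cast hj
    have hp2 : (0 : ℝ) < (m : ℝ) - j := by linarith
    have hle : (m : ℝ) - k ≤ (m : ℝ) - j := by linarith
    rw [div_mul_div_comm, mul_one]
    apply div_le_div_of_nonneg_left hs'0 (mul_pos (pow_pos (by linarith) _) (pow_pos hp2 2))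
    rw [pow_add]
    exact mul_le_mul_of_nonneg_right (pow_le_pow_left₀ (by linarith) hle h₂) (by positivity)
  have hsum : ∑ j ∈ range k, s' / ((m : ℝ) - j) ^ (h₂ + 2) ≤ s' / ((m : ℝ) - k) ^ (h₂ + 1) := by
    calc ∑ j ∈ range k, s' / ((m : ℝ) - j) ^ (h₂ + 2)
        ≤ ∑ j ∈ range k, s' / ((m : ℝ) - k) ^ h₂ * (1 / ((m : ℝ) - j) ^ 2) := sum_le_sum hterm
      _ = s' / ((m : ℝ) - k) ^ h₂ * ∑ j ∈ range k, 1 / ((m : ℝ) - j) ^ 2 := by rw [mul_sum]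
      _ ≤ s' / ((m : ℝ) - k) ^ h₂ * (1 / ((m : ℝ) - k)) :=
          mul_le_mul_of_nonneg_left (RestrictedSubmultSeveral.sum_inv_sq_le hkm) (by positivity)
      _ = s' / ((m : ℝ) - k) ^ (h₂ + 1) := by
          rw [div_mul_div_comm, mul_one, pow_succ]
  have hden : s' / ((m : ℝ) - k + 1) ^ (h₂ + 2) ≤ s' / ((m : ℝ) - k) ^ (h₂ + 2) := by
    apply div_le_div_of_nonneg_left hs'0 (pow_pos (by linarith) _)
    exact pow_le_pow_left₀ (by linarith) (by linarith) _
  have e1 : h₂ + 2 - 1 = h₂ + 1 := by omega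
  rw [e1]
  calc (#(X + ∑ i, B i) : ℝ)
      ≤ (∑ j ∈ range k, s' / ((m : ℝ) - j) ^ (h₂ + 2)) +
          ((#X : ℝ) - k) * (s' / ((m : ℝ) - k + 1) ^ (h₂ + 2)) := hXb
    _ ≤ s' / ((m : ℝ) - k) ^ (h₂ + 1) + ((#X : ℝ) - k) * (s' / ((m : ℝ) - k) ^ (h₂ + 2)) := by
        gcongr

namespace RestrictedSubmultSeveral

/-- [folklore] `|Σᵢ Bᵢ| ≤ ∏ᵢ |Bᵢ|`. -/
private theorem card_sum_le_prod_card {ι : Type*} (s : Finset ι) (B : ι → Finset G) :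
    #(∑ i ∈ s, B i) ≤ ∏ i ∈ s, #(B i) := by
  classical
  induction s using Finset.induction_on with
  | empty => simp
  | insert a s ha ih =>
    rw [sum_insert ha, prod_insert ha]
    exact card_add_le.trans (Nat.mul_le_mul_left _ ih)

/-- The Balister–Bollobás inequality up to the constant `(3h)ʰ` (for `h ≥ 2`): GMR's case
analysis (proof of their Thm 1.4) run for `h` summands with the weak Theorems 4.2/4.3 and the
integer cut `m − |X| = ⌈(s'/|S|)^{1/h}⌉`, giving `|S + A| ≤ 3·(s'|S|^{h−1})^{1/h}`.
[cite: GyarmatiMatolcsiRuzsa2010, proof of Thm 1.4 (h summands, weak constant)] -/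
private theorem card_add_pow_le_const {h : ℕ} (hh : 2 ≤ h) (B : Fin h → Finset G)
    (S A : Finset G) (hS : S ⊆ ∑ i, B i) :
    #(S + A) ^ h ≤ (3 * h) ^ h * (#S ^ (h - 1) * ∏ i, #(A + B i)) := by
  classical
  rcases A.eq_empty_or_nonempty with rfl | hA
  · simp [zero_pow (by omega : h ≠ 0)]
  rcases S.eq_empty_or_nonempty with rfl | hSne
  · simp [zero_pow (by omega : h ≠ 0)]
  have hBne : ∀ i, (B i).Nonempty := by
    intro i
    by_contra hc
    rw [not_nonempty_iff_eq_empty] at hc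
    have := sum_eq_empty_of_eq_empty univ B (mem_univ i) hc
    rw [this] at hS
    exact hSne.ne_empty (subset_empty.1 hS)
  have h1 : 1 ≤ h := by omega
  obtain ⟨P, hP⟩ : ∃ P : ℕ, ∏ i, #(A + B i) = P := ⟨_, rfl⟩
  have hPR : (∏ i, (#(A + B i) : ℝ)) = (P : ℝ) := by rw [← hP]; push_cast; rfl
  rw [hP]
  set m := #A with hm
  set σ := #S with hσ
  have hm1 : 1 ≤ m := hA.card_pos
  have hσ1 : 1 ≤ σ := hSne.card_pos
  have hPpos : 0 < P := by rw [← hP]; exact prod_pos fun i _ => (hA.add (hBne i)).card_pos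
  -- `σ ≤ |Σ Bᵢ| ≤ ∏ |Bᵢ| ≤ ∏ |A + Bᵢ| = P`
  have hσP : σ ≤ P := by
    calc σ ≤ #(∑ i, B i) := card_le_card hS
      _ ≤ ∏ i, #(B i) := card_sum_le_prod_card univ B
      _ ≤ ∏ i, #(A + B i) := prod_le_prod' fun i _ => card_le_card_add_left hA
      _ = P := hP
  -- reals
  have hmR : (1 : ℝ) ≤ m := by exact_mod_cast hm1
  have hσR : (1 : ℝ) ≤ σ := by exact_mod_cast hσ1
  have hσpos : (0 : ℝ) < σ := by linarith
  have hhR : (1 : ℝ) ≤ h := by exact_mod_cast h1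
  set s' : ℝ := (h : ℝ) ^ h * P with hs'
  have hσPR : (σ : ℝ) ≤ P := by exact_mod_cast hσP
  have hσs : (σ : ℝ) ≤ s' := by
    rw [hs']
    have : (1 : ℝ) ≤ (h : ℝ) ^ h := one_le_pow₀ hhR
    nlinarith
  have hs'pos : (0 : ℝ) < s' := by linarith
  -- `u = (s'/σ)^{1/h}`, `R = u σ`
  set u : ℝ := (s' / σ) ^ ((h : ℝ)⁻¹) with hu
  have hupos : 0 < u := Real.rpow_pos_of_pos (div_pos hs'pos hσpos) _
  have huh : u ^ h = s' / σ := by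
    rw [hu]; exact Real.rpow_inv_natCast_pow (div_pos hs'pos hσpos).le (by omega)
  have hu1 : 1 ≤ u := by
    by_contra hc
    push Not at hc
    have : u ^ h < 1 := pow_lt_one₀ hupos.le hc (by omega)
    rw [huh, div_lt_one hσpos] at this
    linarith
  set R : ℝ := u * σ with hR
  have hRpos : 0 ≤ R := by rw [hR]; positivity
  have hσR' : (σ : ℝ) ≤ R := by rw [hR]; nlinarith
  obtain ⟨h₁, hh₁⟩ : ∃ h₁, h = h₁ + 1 := ⟨h - 1, by omega⟩
  have hRu : s' / u ^ h₁ = R := by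
    have hne : u ^ h₁ ≠ 0 := pow_ne_zero _ hupos.ne'
    rw [div_eq_iff hne, hR]
    have : u * σ * u ^ h₁ = u ^ h * σ := by rw [hh₁, pow_succ]; ring
    rw [this, huh]; field_simp
  have hRu2 : s' / u ^ h = σ := by rw [huh]; field_simp
  -- the main estimate `|S + A| ≤ 3R`
  have hmain : (#(S + A) : ℝ) ≤ 3 * R := by
    by_cases hcase : u + 1 ≤ (m : ℝ)
    · set c : ℕ := ⌈u⌉₊ with hc
      have hc1 : 1 ≤ c := Nat.ceil_pos.2 hupos
      have hcu : u ≤ c := Nat.le_ceil u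
      have hcu' : (c : ℝ) < u + 1 := Nat.ceil_lt_add_one hupos.le
      have hcm : c + 1 ≤ m := by
        have : (c : ℝ) < m := by linarith
        have : c < m := by exact_mod_cast this
        omega
      obtain ⟨X, hXA, hXk, hXb⟩ :=
        exists_large_subset_card_add_sum_le' hh B A (k := m - c) (by omega) (by omega)
      have hkc : ((m : ℝ) - ((m - c : ℕ) : ℝ)) = c := by
        rw [Nat.cast_sub (by omega)]; ring
      have hs'' : ((h : ℝ) ^ h * ∏ i, (#(A + B i) : ℝ)) = s' := by
        rw [hs', hPR]
      rw [hs'', ← hm, hkc] at hXb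
      have hXk' : (0 : ℝ) ≤ (#X : ℝ) - ((m - c : ℕ) : ℝ) := by
        have : (((m - c : ℕ)) : ℝ) ≤ #X := by exact_mod_cast hXk
        linarith
      have hcpos : (0 : ℝ) < c := by exact_mod_cast hc1
      have hb1 : s' / (c : ℝ) ^ (h - 1) ≤ R := by
        rw [← hRu, show h - 1 = h₁ by omega]
        exact div_le_div_of_nonneg_left hs'pos.le (pow_pos hupos _)
          (pow_le_pow_left₀ hupos.le hcu _)
      have hb2 : s' / (c : ℝ) ^ h ≤ σ := by
        rw [← hRu2]
        exact div_le_div_of_nonneg_left hs'pos.le (pow_pos hupos _)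
          (pow_le_pow_left₀ hupos.le hcu _)
      have hXb' : (#(X + ∑ i, B i) : ℝ) ≤ R + ((#X : ℝ) - ((m - c : ℕ) : ℝ)) * σ := by
        calc (#(X + ∑ i, B i) : ℝ)
            ≤ s' / (c : ℝ) ^ (h - 1) + ((#X : ℝ) - ((m - c : ℕ) : ℝ)) * (s' / (c : ℝ) ^ h) := hXb
          _ ≤ R + ((#X : ℝ) - ((m - c : ℕ) : ℝ)) * σ := by gcongr
      have hsplit : #(S + A) ≤ #(S + X) + #(S + (A \ X)) := by
        calc #(S + A) = #(S + (X ∪ (A \ X))) := by rw [union_sdiff_of_subset hXA]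
          _ = #((S + X) ∪ (S + A \ X)) := by rw [add_union]
          _ ≤ #(S + X) + #(S + (A \ X)) := card_union_le _ _
      have hSX : #(S + X) ≤ #(X + ∑ i, B i) := by
        refine card_le_card ?_
        rw [add_comm X]
        exact add_subset_add_right hS
      have hSAX : #(S + (A \ X)) ≤ σ * (m - #X) := by
        calc #(S + (A \ X)) ≤ #S * #(A \ X) := card_add_le
          _ = σ * (m - #X) := by rw [card_sdiff_of_subset hXA]
      have hXm : #X ≤ m := by rw [hm]; exact card_le_card hXA
      have htot : (#(S + A) : ℝ) ≤ #(X + ∑ i, B i) + σ * ((m : ℝ) - #X) := by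
        have e1 : ((#(S + A) : ℕ) : ℝ) ≤ ((#(X + ∑ i, B i) + σ * (m - #X) : ℕ) : ℝ) := by
          exact_mod_cast hsplit.trans (add_le_add hSX hSAX)
        push_cast [Nat.cast_sub hXm] at e1
        exact e1
      calc (#(S + A) : ℝ) ≤ #(X + ∑ i, B i) + σ * ((m : ℝ) - #X) := htot
        _ ≤ R + ((#X : ℝ) - ((m - c : ℕ) : ℝ)) * σ + σ * ((m : ℝ) - #X) := by linarith
        _ = R + σ * ((m : ℝ) - ((m - c : ℕ) : ℝ)) := by ring
        _ = R + σ * c := by rw [hkc]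
        _ ≤ R + σ * (u + 1) := by gcongr
        _ = R + R + σ := by rw [hR]; ring
        _ ≤ 3 * R := by linarith
    · have hcase : (m : ℝ) < u + 1 := lt_of_not_ge hcase
      have e1 : (#(S + A) : ℝ) ≤ σ * m := by
        have := card_add_le (s := S) (t := A)
        exact_mod_cast this
      calc (#(S + A) : ℝ) ≤ σ * m := e1
        _ ≤ σ * (u + 1) := by gcongr
        _ = R + σ := by rw [hR]; ring
        _ ≤ 3 * R := by linarith
  -- raise to the `h`-th power and clear the reals
  have hfin : ((#(S + A) : ℕ) : ℝ) ^ h ≤ (3 * h : ℝ) ^ h * ((σ : ℝ) ^ (h - 1) * P) := by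
    have h0 : (0 : ℝ) ≤ #(S + A) := by positivity
    have e2 : (σ : ℝ) ^ h = (σ : ℝ) ^ (h - 1) * σ := by
      rw [← pow_succ, show h - 1 + 1 = h by omega]
    calc ((#(S + A) : ℕ) : ℝ) ^ h ≤ (3 * R) ^ h := pow_le_pow_left₀ h0 hmain h
      _ = 3 ^ h * (u ^ h * (σ : ℝ) ^ h) := by rw [hR, mul_pow, mul_pow]
      _ = 3 ^ h * (s' * (σ : ℝ) ^ (h - 1)) := by
          rw [huh, e2]; field_simp
      _ = (3 * h : ℝ) ^ h * ((σ : ℝ) ^ (h - 1) * P) := by rw [hs', mul_pow]; ring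
  exact_mod_cast hfin

/-- [folklore] The limiting step of the tensor-power trick: `xⁿ ≤ C yⁿ` for all `n` forces
`x ≤ y` (Bernoulli). -/
private theorem le_of_pow_le_const_mul_pow {x y C : ℕ} (h : ∀ n : ℕ, x ^ n ≤ C * y ^ n) :
    x ≤ y := by
  by_contra hxy
  have hxy : y < x := lt_of_not_ge hxy
  rcases Nat.eq_zero_or_pos y with rfl | hy
  · have := h 1
    simp at this
    omega
  set n := (C + 1) * y with hn
  have hyR : (0 : ℝ) < y := by exact_mod_cast hy
  have h1 : ((y : ℝ) + 1) ^ n ≤ C * (y : ℝ) ^ n := by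
    have hxy' : y + 1 ≤ x := hxy
    have : (y + 1) ^ n ≤ C * y ^ n := (Nat.pow_le_pow_left hxy' n).trans (h n)
    exact_mod_cast this
  have h2 : (1 + (n : ℝ) * (1 / y)) ≤ (1 + 1 / (y : ℝ)) ^ n :=
    one_add_mul_le_pow (by
      have : (0 : ℝ) ≤ 1 / y := by positivity
      linarith) n
  have h3 : (n : ℝ) * (1 / y) = C + 1 := by
    rw [hn]; push_cast; field_simp
  rw [h3] at h2
  have h4 : (1 + 1 / (y : ℝ)) ^ n * (y : ℝ) ^ n = ((y : ℝ) + 1) ^ n := by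
    rw [← mul_pow]; congr 1; field_simp
  have hyn : (0 : ℝ) < (y : ℝ) ^ n := pow_pos hyR n
  have h5 : (1 + ((C : ℝ) + 1)) * (y : ℝ) ^ n ≤ C * (y : ℝ) ^ n := by
    calc (1 + ((C : ℝ) + 1)) * (y : ℝ) ^ n ≤ (1 + 1 / (y : ℝ)) ^ n * (y : ℝ) ^ n :=
          mul_le_mul_of_nonneg_right h2 hyn.le
      _ = ((y : ℝ) + 1) ^ n := h4
      _ ≤ C * (y : ℝ) ^ n := h1
  nlinarith

/-- [folklore] Cartesian powers of finset sums: `(Σᵢ Bᵢ)ⁿ = Σᵢ Bᵢⁿ` in `(Fin n → G)`. -/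
private theorem piFinset_sum {ι : Type*} (s : Finset ι) (B : ι → Finset G) (n : ℕ) :
    (Fintype.piFinset fun _ : Fin n => ∑ i ∈ s, B i) =
      ∑ i ∈ s, Fintype.piFinset fun _ : Fin n => B i := by
  classical
  induction s using Finset.induction_on with
  | empty =>
    simp only [sum_empty]
    rw [← Finset.singleton_zero, Fintype.piFinset_singleton]
    rfl
  | insert a s ha ih =>
    rw [sum_insert ha, sum_insert ha, ← ih, ← Fintype.piFinset_add]

end RestrictedSubmultSeveral

/-- **Balister–Bollobás 2012, Theorem 9** (= Murphy–Palsson–Petridis 2015, Theorem 4; for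
`h = 2` Gyarmati–Matolcsi–Ruzsa 2010, Theorem 1.4).  "If `A, B₁, …, B_k` are finite sets [BB: of
integers; MPP: in a commutative group] and `C ⊆ B₁ + ⋯ + B_k`, then
`|A + C|ᵏ ≤ |C|^{k−1} ∏ᵢ |A + Bᵢ|`."  Proved here for every additive commutative group and every
`k = h ≥ 0`, by the Plünnecke route of GMR 2010 §4 run for `h` summands and the direct-power trick
— NOT by the printed projection argument, whose step `|S′_{[k]}| ≤ |C|` fails for
`C ⊊ B₁ + ⋯ + B_k` (see the module docstring).
[cite: BalisterBollobas2012, Thm 9] [cite: MurphyPalssonPetridis2015, Thm 4] -/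
theorem card_add_pow_le_card_pow_mul_prod_card_add {h : ℕ} (B : Fin h → Finset G)
    (S A : Finset G) (hS : S ⊆ ∑ i, B i) :
    #(S + A) ^ h ≤ #S ^ (h - 1) * ∏ i, #(A + B i) := by
  classical
  rcases Nat.lt_or_ge h 2 with hh | hh
  · interval_cases h
    · simp
    · -- `h = 1`: `S ⊆ B 0`, so `S + A ⊆ A + B 0`
      simp only [pow_one, Nat.sub_self, pow_zero, one_mul, Fin.prod_univ_one]
      rw [Fin.sum_univ_one] at hS
      rw [add_comm S A]
      exact card_le_card (add_subset_add_left hS)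
  apply RestrictedSubmultSeveral.le_of_pow_le_const_mul_pow (C := (3 * h) ^ h)
  intro n
  let S' : Finset (Fin n → G) := Fintype.piFinset fun _ => S
  let A' : Finset (Fin n → G) := Fintype.piFinset fun _ => A
  let B' : Fin h → Finset (Fin n → G) := fun i => Fintype.piFinset fun _ => B i
  have hS' : S' ⊆ ∑ i, B' i := by
    rw [← RestrictedSubmultSeveral.piFinset_sum]
    exact Fintype.piFinset_subset _ _ fun _ => hS
  have h0 := RestrictedSubmultSeveral.card_add_pow_le_const hh B' S' A' hS'
  have cpow : ∀ T : Finset G, #(Fintype.piFinset fun _ : Fin n => T) = #T ^ n := by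
    intro T; rw [Fintype.card_piFinset, prod_const, card_univ, Fintype.card_fin]
  have cS : #S' = #S ^ n := cpow S
  have cSA : #(S' + A') = #(S + A) ^ n := by
    rw [show S' + A' = Fintype.piFinset fun _ : Fin n => S + A from (Fintype.piFinset_add _ _).symm]
    exact cpow _
  have cB : ∀ i, #(A' + B' i) = #(A + B i) ^ n := by
    intro i
    rw [show A' + B' i = Fintype.piFinset fun _ : Fin n => A + B i from
      (Fintype.piFinset_add _ _).symm]
    exact cpow _
  rw [cSA, cS] at h0
  simp_rw [cB] at h0
  calc (#(S + A) ^ h) ^ n = (#(S + A) ^ n) ^ h := pow_right_comm _ _ _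
    _ ≤ (3 * h) ^ h * ((#S ^ n) ^ (h - 1) * ∏ i, #(A + B i) ^ n) := h0
    _ = (3 * h) ^ h * (#S ^ (h - 1) * ∏ i, #(A + B i)) ^ n := by
        rw [pow_right_comm, prod_pow, ← mul_pow]

/-- Ratio form: `|A + Bᵢ| ≤ Kᵢ|A|`, `S ⊆ Σ Bᵢ` ⇒ `|S + A|ʰ ≤ (∏ Kᵢ)·|S|^{h−1}·|A|ʰ`
(Balister–Bollobás: `|A + C| ≤ (α₁⋯α_h)^{1/h} m |C|^{1−1/h}`).
[cite: MurphyPalssonPetridis2015, Thm 4 (ratio form)] -/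
theorem card_add_pow_le_of_doubling {h : ℕ} (B : Fin h → Finset G) (S A : Finset G)
    (hS : S ⊆ ∑ i, B i) (K : Fin h → ℝ) (hK : ∀ i, (#(A + B i) : ℝ) ≤ K i * #A) :
    ((#(S + A) : ℕ) : ℝ) ^ h ≤ (∏ i, K i) * (#S : ℝ) ^ (h - 1) * (#A : ℝ) ^ h := by
  have h0 := card_add_pow_le_card_pow_mul_prod_card_add B S A hS
  have h1 : ((#(S + A) : ℕ) : ℝ) ^ h ≤ (#S : ℝ) ^ (h - 1) * ∏ i, (#(A + B i) : ℝ) := by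
    exact_mod_cast h0
  have h2 : ∏ i, (#(A + B i) : ℝ) ≤ ∏ i, (K i * #A) :=
    prod_le_prod (fun i _ => by positivity) fun i _ => hK i
  calc ((#(S + A) : ℕ) : ℝ) ^ h ≤ (#S : ℝ) ^ (h - 1) * ∏ i, (#(A + B i) : ℝ) := h1
    _ ≤ (#S : ℝ) ^ (h - 1) * ∏ i, (K i * #A) := by gcongr
    _ = (∏ i, K i) * (#S : ℝ) ^ (h - 1) * (#A : ℝ) ^ h := by
        rw [prod_mul_distrib, prod_const, card_univ, Fintype.card_fin]; ring

/-- **Ruzsa's Plünnecke–Ruzsa inequality for different summands** (the `X`-free form, constant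
`1`): "`|A| = m`, `|A + Bᵢ| ≤ αᵢ m` ⇒ `|B₁ + ⋯ + B_h| ≤ α₁⋯α_h m`" (Murphy–Palsson–Petridis 2015,
Thm 5, second display; Ruzsa 1989; GMR 2010 Thm 4.2), multiplied out:
`|Σ Bᵢ|·m^{h−1} ≤ ∏|A + Bᵢ|`.  Proof: the weak subset form `exists_subset_card_add_sum_le`
(factor `hʰ`) in the direct powers `(Fin n → G)` and `n → ∞`.  (For `h = 2` this is Ruzsa's
triangle inequality, Mathlib `Finset.ruzsa_triangle_inequality_add_add_add`.)
[cite: MurphyPalssonPetridis2015, Thm 5 (X-free consequence)] -/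
theorem card_sum_mul_card_pow_le_prod_card_add {h : ℕ} (B : Fin h → Finset G) (A : Finset G)
    (hA : A.Nonempty) : #(∑ i, B i) * #A ^ (h - 1) ≤ ∏ i, #(A + B i) := by
  classical
  rcases Nat.eq_zero_or_pos h with rfl | hh
  · simp
  apply RestrictedSubmultSeveral.le_of_pow_le_const_mul_pow (C := h ^ h)
  intro n
  let A' : Finset (Fin n → G) := Fintype.piFinset fun _ => A
  let B' : Fin h → Finset (Fin n → G) := fun i => Fintype.piFinset fun _ => B i
  have cpow : ∀ T : Finset G, #(Fintype.piFinset fun _ : Fin n => T) = #T ^ n := by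
    intro T; rw [Fintype.card_piFinset, prod_const, card_univ, Fintype.card_fin]
  have hmn : #A' = #A ^ n := cpow A
  have hA' : A'.Nonempty := by rw [← card_pos, hmn]; exact pow_pos hA.card_pos _
  obtain ⟨X, hXA, hXne, hX⟩ := exists_subset_card_add_sum_le B' A' hA'
  have cB : ∀ i, #(A' + B' i) = #(A + B i) ^ n := by
    intro i
    rw [show A' + B' i = Fintype.piFinset fun _ : Fin n => A + B i from
      (Fintype.piFinset_add _ _).symm]
    exact cpow _
  have cSum : #(∑ i, B' i) = #(∑ i, B i) ^ n := by
    rw [show (∑ i, B' i) = Fintype.piFinset fun _ : Fin n => ∑ i, B i from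
      (RestrictedSubmultSeveral.piFinset_sum univ B n).symm]
    exact cpow _
  have hA'pos : 0 < #A' := hA'.card_pos
  obtain ⟨h₁, rfl⟩ : ∃ h₁, h = h₁ + 1 := ⟨h - 1, by omega⟩
  have h2 : #(∑ i, B' i) * #A' ^ h₁ * #A' ≤ (h₁ + 1) ^ (h₁ + 1) * (∏ i, #(A' + B' i)) * #A' := by
    calc #(∑ i, B' i) * #A' ^ h₁ * #A' = #(∑ i, B' i) * #A' ^ (h₁ + 1) := by rw [pow_succ]; ring
      _ ≤ #(X + ∑ i, B' i) * #A' ^ (h₁ + 1) :=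
          Nat.mul_le_mul_right _ (card_le_card_add_left hXne)
      _ ≤ (h₁ + 1) ^ (h₁ + 1) * (∏ i, #(A' + B' i)) * #X := hX
      _ ≤ (h₁ + 1) ^ (h₁ + 1) * (∏ i, #(A' + B' i)) * #A' :=
          Nat.mul_le_mul_left _ (card_le_card hXA)
  have h3 := Nat.le_of_mul_le_mul_right h2 hA'pos
  rw [cSum, hmn] at h3
  simp_rw [cB] at h3
  simp only [Nat.add_sub_cancel]
  calc (#(∑ i, B i) * #A ^ h₁) ^ n = #(∑ i, B i) ^ n * (#A ^ n) ^ h₁ := by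
        rw [mul_pow, pow_right_comm]
    _ ≤ (h₁ + 1) ^ (h₁ + 1) * ∏ i, #(A + B i) ^ n := h3
    _ = (h₁ + 1) ^ (h₁ + 1) * (∏ i, #(A + B i)) ^ n := by rw [prod_pow]

/-- **Murphy–Palsson–Petridis 2015, Theorem 1** ("the best known upper bound"; deduced in
[MPP15, §2] exactly as here, from the Balister–Bollobás inequality with `C = B₁ + ⋯ + B_h` and
Ruzsa's inequality): "`|A| = m`, `|A + Bᵢ| ≤ αᵢ m` ⇒ `|A + B₁ + ⋯ + B_h| ≤ α₁⋯α_h m^{2−1/h}`",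
multiplied out: `|A + Σ Bᵢ|ʰ · m^{(h−1)²} ≤ (∏ |A + Bᵢ|)ʰ`.
[cite: MurphyPalssonPetridis2015, Thm 1] -/
theorem card_add_sum_pow_mul_card_pow_le {h : ℕ} (B : Fin h → Finset G) (A : Finset G) :
    #(A + ∑ i, B i) ^ h * #A ^ ((h - 1) ^ 2) ≤ (∏ i, #(A + B i)) ^ h := by
  classical
  rcases Nat.eq_zero_or_pos h with rfl | hh
  · simp
  rcases A.eq_empty_or_nonempty with rfl | hA
  · simp [zero_pow (by omega : h ≠ 0)]
  have h1 := card_add_pow_le_card_pow_mul_prod_card_add B (∑ i, B i) A subset_rfl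
  have h2 := card_sum_mul_card_pow_le_prod_card_add B A hA
  have h3 : (#(∑ i, B i) * #A ^ (h - 1)) ^ (h - 1) ≤ (∏ i, #(A + B i)) ^ (h - 1) :=
    Nat.pow_le_pow_left h2 _
  rw [add_comm A]
  calc #(∑ i, B i + A) ^ h * #A ^ ((h - 1) ^ 2)
      = #(∑ i, B i + A) ^ h * (#A ^ (h - 1)) ^ (h - 1) := by rw [← pow_mul, sq]
    _ ≤ #(∑ i, B i) ^ (h - 1) * (∏ i, #(A + B i)) * (#A ^ (h - 1)) ^ (h - 1) :=
        Nat.mul_le_mul_right _ h1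
    _ = (#(∑ i, B i) * #A ^ (h - 1)) ^ (h - 1) * ∏ i, #(A + B i) := by rw [mul_pow]; ring
    _ ≤ (∏ i, #(A + B i)) ^ (h - 1) * ∏ i, #(A + B i) := Nat.mul_le_mul_right _ h3
    _ = (∏ i, #(A + B i)) ^ h := by rw [← pow_succ, Nat.sub_add_cancel hh]

end Literature.Combinatorics.Additive
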